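import Literature.Analysis.OperatorTheory.YangMillsMatrixModelDiscreteSpectrum
import Mathlib.Analysis.Calculus.LineDeriv.IntegrationByParts
import Mathlib.Analysis.SpecialFunctions.Sqrt
import HarnessLib

/-!
# Simon's zero-point (valley-confinement) bound for Lüscher's `SU(2)` matrix-model Hamiltonian — PROVED

Topic `Literature/Analysis/OperatorTheory`, a proofs sibling of `YangMillsMatrixModelDiscreteSpectrum.lean`
(the energy form `energyForm ψ = ∫ ½|∇ψ|² + V ψ²` of `𝔥 = −½Δ + V`, `V(x) = ¼ Σ_{i,j} |x_i × x_j|²` on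
`ℝ⁹ = (ℝ³)³`, its `C²_c` trial functions `IsTestFn`, and the named fact `LuscherSimonGap`).  The potential
`V` VANISHES on the 5-dimensional valley of parallel triples (`luscherPotential_parallel`), so no bound
`V(x) ≥ c|x| − C` holds; nevertheless the QUADRATIC FORM of `𝔥` dominates a linearly confining weight.
Proved here, for every `C²_c` trial function `ψ` and every spatial direction `i`:

* ★ `two_mul_integral_colourNorm_sq_le_energyForm` — **`2 ∫ |x_i| ψ(x)² dx ≤ 𝔮(ψ)`**, i.e. `𝔥 ≥ 2|x_i|`
  as forms (`|x_i| = (x_i·x_i)^{1/2}` the length of the `i`-th colour vector);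
* `integral_sum_colourNorm_sq_le_energyForm` — `⅔ ∫ (|x_1|+|x_2|+|x_3|) ψ² ≤ 𝔮(ψ)`;
* ★ `integral_norm_sq_le_energyForm` — **`⅔ ∫ ‖x‖ ψ(x)² dx ≤ 𝔮(ψ)`**, and the shape of Simon's eq. (5),
  `energyForm_ge_half_add_third_integral_norm`: `𝔮(ψ) ≥ ½𝔮(ψ) + ⅓∫‖x‖ψ²` ("`H₁ ≥ ½(−Δ) + ½(|x|+|y|)`");
* `integral_norm_sq_le_of_energyForm_le` — a trial state with Rayleigh quotient `≤ s` (the condition in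
  `minmaxLevel`) has `∫ ‖x‖ ψ² ≤ (3/2) s ‖ψ‖²` (localisation of low-energy states near the origin of
  the valley — the input of any compactness proof of `μ_k → ∞`, and of the IMS localisation step of the
  one-site semiclassics it models, cf. Lüscher's linearly rising effective potential along the valley).

METHOD = B. Simon, *Some quantum operators with discrete spectrum but classically continuous spectrum*,
Ann. Phys. 146 (1983) 209–220, **§2 "First proof: zero point oscillator motion"** (p. 211–212, read on
`lit:paper:doi-10-1016-0003-4916-83-90057-x` p0003–p0004): *"It is, of course, well known that
`−d²/dy² + x²y² ≥ |x|`. Thus, treating `y` as c-number, … Using symmetry in `x` and `y` and adding, we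
see that `H₁ ≥ ½(−Δ) + ½(|x|+|y|) = H₃` (5). Since `H₃` has discrete spectrum, so does `H₁`."* — here
TRANSPORTED from `x²y²` to the operator (3) of op. cit. (`H = −Σ Δ_{A_i} − Σ_{i<j} Tr([A_i,A_j]²)` on
`L²(𝔞^ν)`) with `𝔞 = su(2) ≅ (ℝ³, ×)`, `ν = 3`, which is Lüscher's `𝔥` up to positive constants; for (3)
itself op. cit. argues via Fefferman–Phong (**Cor. 4**, p. 217, *"The operator of (3) has purely
discrete spectrum"*), so the inequality `𝔥 ≥ 2|x_i|` with its constant is this file's rendering of the §2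
method, not a display of the paper.  The transverse oscillators: for fixed `x_i ≠ 0` and `j ≠ i`,
`½|∇_{x_j}ψ|² + ½|x_i × x_j|² ψ²` is a harmonic oscillator of frequency `|x_i|` in the two components of
`x_j` orthogonal to `x_i`, with zero-point energy `2 · |x_i|/2`; the two blocks `j ≠ i` give `2|x_i|`.

PROOF (kernel-checked, elementary; no unbounded operators).  With the smoothed valley distance
`ρ_ε = (|x_i|² + ε²)^{1/2}` and the transverse field `F^{ε}_b = (|x_i|² x_{j,b} − (x_i·x_j) x_{i,b})/ρ_ε`
(`= |x_i| (P^⊥_{x_i} x_j)_b` at `ε = 0`): `Σ_b (F^{ε}_b)² ≤ |x_i × x_j|²` (Lagrange's identity,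
`sum_tfield_sq_le`), `Σ_b ∂_{(j,b)} F^{ε}_b = 2|x_i|²/ρ_ε ≥ 2(|x_i| − ε)` (`sum_tderiv`,
`two_mul_csq_div_rho_ge`), `F^{ε}` is affine along every line `x + t e_{(j,b')}` (`hasLineDerivAt_tfield`);
then `0 ≤ ∫ Σ_b (∂_{(j,b)}ψ + F^{ε}_b ψ)²`, the cross term being `−∫ (div F^{ε}) ψ²` by Mathlib's
integration by parts for line derivatives (`integral_bilinear_hasLineDerivAt_right_eq_neg_left_of_integrable`,
no boundary terms: compact support) — `two_mul_integral_sqrt_csq_le_block`; finally `ε ↓ 0`, the sum over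
the two blocks `j ≠ i`, `‖∇ψ‖² = Σ_p (∂_pψ)²` (`norm_gradient_sq`) and `V ≥ ½ Σ_{j≠i} |x_i × x_j|²`
(`half_sum_crossSq_le_potential`).

NOT here (the remaining content of the named fact `LuscherSimonGap`, unchanged and still a hypothesis
where used): the compactness half of Simon's sentence (`μ_k → ∞` for the confining form, Rellich /
Reed–Simon XIII.64) and the simplicity of the ground state (`0 < luscherEps1`, Perron–Frobenius,
Reed–Simon XIII.48).  No definition of an operator, no new named fact; everything is a theorem.

## References

* [SimonB1983DiscreteSpectrum] B. Simon, Ann. Phys. 146 (1983) 209–220, doi:10.1016/0003-4916(83)90057-x —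
  §2 eq. (5) p. 212 (method), eq. (3) p. 211 and Cor. 4 p. 217 (the Lie-algebra operator), §1 p. 211
  ("potentials fail to go to infinity at infinity but only on very thin sets").
* [Luscher1983] M. Lüscher, *Some analytic results concerning the mass spectrum of Yang–Mills gauge
  theories on a torus*, Nucl. Phys. B 219 (1983) 233–261, §2 (the effective potential along the valley
  of the zero-momentum modes).
* [ReedSimonIV1978] M. Reed, B. Simon, *Methods of Modern Mathematical Physics IV*, Thm. XIII.2 (forms on a
  core of `C²_c` functions), Thm. XIII.64.
-/

noncomputable section

open Matrix MeasureTheory Filter Topology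
open scoped BigOperators

namespace Literature.Analysis.OperatorTheory.YMMatrixModel

/-! ### 1. Coordinates, unit directions, partial derivatives -/

/-- The unit coordinate vector `e_p` of `ℝ⁹`, `p = (i, a)` (spatial direction `i`, colour `a`). [folklore] -/
def unitDir (p : Fin 3 × Fin 3) : ZM := EuclideanSpace.single p (1 : ℝ)

/-- Coordinates of `e_p`. [cite: SimonB1983DiscreteSpectrum, §2 eq. (5)] -/
@[simp] theorem unitDir_apply (p q : Fin 3 × Fin 3) : unitDir p q = if q = p then 1 else 0 := by
  simp [unitDir]

/-- The partial derivative `∂_p ψ (x) = Dψ(x) e_p` of a function on `ℝ⁹`. [folklore] -/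
def pderiv (p : Fin 3 × Fin 3) (ψ : ZM → ℝ) (x : ZM) : ℝ := fderiv ℝ ψ x (unitDir p)

/-- Moving along `e_{(j,b)}` does not change the colour vectors `x_i`, `i ≠ j`.
[cite: SimonB1983DiscreteSpectrum, §2 eq. (5)] -/
theorem colourVec_add_smul_unitDir_of_ne (x : ZM) (t : ℝ) {i j : Fin 3} (hij : i ≠ j) (b : Fin 3) :
    colourVec (x + t • unitDir (j, b)) i = colourVec x i := by
  funext c
  simp [colourVec, hij]

/-- Moving along `e_{(j,b)}` shifts `x_j` by `t e_b`. [cite: SimonB1983DiscreteSpectrum, §2 eq. (5)] -/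
theorem colourVec_add_smul_unitDir_self (x : ZM) (t : ℝ) (j b : Fin 3) :
    colourVec (x + t • unitDir (j, b)) j = colourVec x j + t • Pi.single b 1 := by
  funext c
  simp [colourVec, Pi.single_apply]

/-- `‖∇ψ(x)‖² = Σ_p (∂_p ψ(x))²` (the Laplacian's form is the sum of the squared partials).
[cite: ReedSimonIV1978, Thm. XIII.2] -/
theorem norm_gradient_sq (ψ : ZM → ℝ) (x : ZM) :
    ‖gradient ψ x‖ ^ 2 = ∑ p, (pderiv p ψ x) ^ 2 := by
  rw [EuclideanSpace.real_norm_sq_eq]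
  refine Finset.sum_congr rfl fun p _ => ?_
  have h : (gradient ψ x) p = pderiv p ψ x := by
    have h1 := EuclideanSpace.inner_single_right p (1 : ℝ) (gradient ψ x)
    simp only [one_mul, conj_trivial] at h1
    rw [← h1, inner_gradient_left]
    rfl
  rw [h]

/-- Continuity of the coordinate functions of `ℝ⁹`. [folklore] -/
private theorem continuous_coord (p : Fin 3 × Fin 3) : Continuous fun x : ZM => x p :=
  (EuclideanSpace.proj p).continuous

/-! ### 2. The `ε`-smoothed transverse-oscillator field (Simon's "treating `y` as a c-number") -/

/-- `|x_i|² = x_i · x_i`. [cite: SimonB1983DiscreteSpectrum, §2 eq. (5)] -/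
def csq (i : Fin 3) (x : ZM) : ℝ := colourVec x i ⬝ᵥ colourVec x i

/-- `|x_i|² ≥ 0`. [cite: SimonB1983DiscreteSpectrum, §2 eq. (5)] -/
theorem csq_nonneg (i : Fin 3) (x : ZM) : 0 ≤ csq i x := by
  unfold csq dotProduct
  exact Finset.sum_nonneg fun _ _ => mul_self_nonneg _

/-- `|x_i|² = Σ_b x_{i,b}²`. [cite: SimonB1983DiscreteSpectrum, §2 eq. (5)] -/
theorem csq_eq_sum (i : Fin 3) (x : ZM) : csq i x = ∑ b, x (i, b) ^ 2 := by
  simp [csq, dotProduct, colourVec, sq]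

/-- `‖x‖² = Σ_i |x_i|²` on `ℝ⁹ = (ℝ³)³`. [cite: SimonB1983DiscreteSpectrum, §2 eq. (5)] -/
theorem norm_sq_eq_sum_csq (x : ZM) : ‖x‖ ^ 2 = ∑ i, csq i x := by
  rw [EuclideanSpace.real_norm_sq_eq, Fintype.sum_prod_type]
  simp [csq_eq_sum]

/-- The transverse square `|x_i × x_j|²`. [cite: SimonB1983DiscreteSpectrum, eq. (3) p. 211] -/
def crossSq (i j : Fin 3) (x : ZM) : ℝ :=
  (colourVec x i ⨯₃ colourVec x j) ⬝ᵥ (colourVec x i ⨯₃ colourVec x j)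

/-- `|x_i × x_j|² ≥ 0`. [cite: SimonB1983DiscreteSpectrum, eq. (3) p. 211] -/
theorem crossSq_nonneg (i j : Fin 3) (x : ZM) : 0 ≤ crossSq i j x := by
  unfold crossSq dotProduct
  exact Finset.sum_nonneg fun _ _ => mul_self_nonneg _

/-- `|x_i × x_j|² = |x_j × x_i|²`. [cite: SimonB1983DiscreteSpectrum, eq. (3) p. 211] -/
theorem crossSq_comm (i j : Fin 3) (x : ZM) : crossSq i j x = crossSq j i x := by
  simp only [crossSq, cross_dot_cross, dotProduct_comm (colourVec x j) (colourVec x i)]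
  ring

/-- `|x_i × x_i|² = 0`. [cite: SimonB1983DiscreteSpectrum, eq. (3) p. 211] -/
theorem crossSq_self (i : Fin 3) (x : ZM) : crossSq i i x = 0 := by
  simp [crossSq, cross_self]

/-- Lüscher's potential in terms of the transverse squares: `V = ¼ Σ_{i,j} |x_i × x_j|²`.
[cite: SimonB1983DiscreteSpectrum, eq. (3) p. 211] -/
theorem luscherPotential_eq_sum_crossSq (x : ZM) :
    luscherPotential x = (1 / 4 : ℝ) * ∑ i, ∑ j, crossSq i j x := rfl

/-- `ρ_ε(x) = √(|x_i|² + ε²)`, the smoothed valley distance. [cite: SimonB1983DiscreteSpectrum, §2 eq. (5)] -/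
def rho (ε : ℝ) (i : Fin 3) (x : ZM) : ℝ := Real.sqrt (csq i x + ε ^ 2)

/-- `ρ_ε > 0` for `ε > 0`. [cite: SimonB1983DiscreteSpectrum, §2 eq. (5)] -/
theorem rho_pos {ε : ℝ} (hε : 0 < ε) (i : Fin 3) (x : ZM) : 0 < rho ε i x :=
  Real.sqrt_pos.2 (add_pos_of_nonneg_of_pos (csq_nonneg i x) (pow_pos hε 2))

/-- `ρ_ε² = |x_i|² + ε²`. [cite: SimonB1983DiscreteSpectrum, §2 eq. (5)] -/
theorem rho_sq (ε : ℝ) (i : Fin 3) (x : ZM) : rho ε i x ^ 2 = csq i x + ε ^ 2 :=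
  Real.sq_sqrt (add_nonneg (csq_nonneg _ _) (sq_nonneg _))

/-- The smoothed transverse field in the `x_j`-block, colour component `b`:
`F^{ε}_{b}(x) = (|x_i|² x_{j,b} − (x_i·x_j) x_{i,b}) / ρ_ε(x) = (|x_i|²/ρ_ε)·(P^⊥_{x_i} x_j)_b`
(for `ε = 0`: `|x_i|` times the component of `x_j` orthogonal to `x_i`, the gradient of the
transverse harmonic-oscillator Gaussian `exp(−|x_i| |P^⊥ x_j|²/2)`). [cite: SimonB1983DiscreteSpectrum, §2 eq. (5)] -/
def tfield (ε : ℝ) (i j b : Fin 3) (x : ZM) : ℝ :=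
  (csq i x * x (j, b) - (colourVec x i ⬝ᵥ colourVec x j) * x (i, b)) / rho ε i x

/-- The `∂_{(j,b)}`-derivative of `F^{ε}_b`: `(|x_i|² − x_{i,b}²)/ρ_ε`. [cite: SimonB1983DiscreteSpectrum, §2 eq. (5)] -/
def tderiv (ε : ℝ) (i b : Fin 3) (x : ZM) : ℝ := (csq i x - x (i, b) ^ 2) / rho ε i x

/-- The divergence of the transverse field: `Σ_b ∂_{(j,b)} F^{ε}_b = 2|x_i|²/ρ_ε` (two transverse
dimensions, each contributing the zero-point energy `|x_i|`). [cite: SimonB1983DiscreteSpectrum, §2 eq. (5)] -/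
theorem sum_tderiv (ε : ℝ) (i : Fin 3) (x : ZM) : ∑ b, tderiv ε i b x = 2 * csq i x / rho ε i x := by
  simp only [tderiv, ← Finset.sum_div]
  congr 1
  rw [Finset.sum_sub_distrib, Finset.sum_const, Finset.card_univ, Fintype.card_fin, ← csq_eq_sum]
  simp only [nsmul_eq_mul, Nat.cast_ofNat]
  ring

/-- Lagrange's identity for the numerators: `Σ_b (|x_i|² x_{j,b} − (x_i·x_j) x_{i,b})² = |x_i|² |x_i × x_j|²`.
[cite: SimonB1983DiscreteSpectrum, §2 eq. (5)] -/
theorem sum_numerator_sq (i j : Fin 3) (x : ZM) :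
    ∑ b, (csq i x * x (j, b) - (colourVec x i ⬝ᵥ colourVec x j) * x (i, b)) ^ 2 =
      csq i x * crossSq i j x := by
  rw [crossSq, cross_dot_cross]
  simp only [csq, dotProduct, colourVec, Fin.sum_univ_three]
  ring

/-- `Σ_b (F^{ε}_b)² ≤ |x_i × x_j|²` (the field never exceeds the potential it is paid from; for
`ε = 0` this is an equality off the valley). [cite: SimonB1983DiscreteSpectrum, §2 eq. (5)] -/
theorem sum_tfield_sq_le (ε : ℝ) (i j : Fin 3) (x : ZM) :
    ∑ b, (tfield ε i j b x) ^ 2 ≤ crossSq i j x := by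
  have hT := crossSq_nonneg i j x
  simp only [tfield, div_pow, ← Finset.sum_div, sum_numerator_sq]
  by_cases h : rho ε i x = 0
  · simp [h, hT]
  · have h2 : 0 < rho ε i x ^ 2 := by positivity
    rw [div_le_iff₀ h2, rho_sq]
    nlinarith [csq_nonneg i x, sq_nonneg ε, hT]

/-- Along the line `t ↦ x + t e_{(j,b')}` (`i ≠ j`) the field component `F^{ε}_b` is AFFINE in `t`,
with slope `(|x_i|² δ_{bb'} − x_{i,b'} x_{i,b})/ρ_ε`. [cite: SimonB1983DiscreteSpectrum, §2 eq. (5)] -/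
theorem hasLineDerivAt_tfield {i j : Fin 3} (hij : i ≠ j) (ε : ℝ) (b b' : Fin 3) (x : ZM) :
    HasLineDerivAt ℝ (tfield ε i j b)
      ((csq i x * (if b = b' then 1 else 0) - x (i, b') * x (i, b)) / rho ε i x) x (unitDir (j, b')) := by
  unfold HasLineDerivAt
  have hfun : (fun t : ℝ => tfield ε i j b (x + t • unitDir (j, b'))) = fun t =>
      ((csq i x * x (j, b) - (colourVec x i ⬝ᵥ colourVec x j) * x (i, b)) +
        t * (csq i x * (if b = b' then 1 else 0) - x (i, b') * x (i, b))) / rho ε i x := by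
    funext t
    have hcv := colourVec_add_smul_unitDir_of_ne x t hij b'
    have hcsq : csq i (x + t • unitDir (j, b')) = csq i x := by simp only [csq, hcv]
    have hrho : rho ε i (x + t • unitDir (j, b')) = rho ε i x := by simp only [rho, hcsq]
    have hxi : (x + t • unitDir (j, b')) (i, b) = x (i, b) := by
      exact congrFun hcv b
    have hxj : (x + t • unitDir (j, b')) (j, b) = x (j, b) + (if b = b' then t else 0) := by
      simp
    have hdot : colourVec (x + t • unitDir (j, b')) i ⬝ᵥ colourVec (x + t • unitDir (j, b')) j =
        colourVec x i ⬝ᵥ colourVec x j + t * x (i, b') := by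
      rw [hcv, colourVec_add_smul_unitDir_self, dotProduct_add, dotProduct_smul, dotProduct_single,
        smul_eq_mul, mul_one]
      rfl
    rw [tfield, hcsq, hrho, hxi, hxj, hdot]
    split_ifs <;> ring
  rw [hfun]
  have h := (((hasDerivAt_id (0 : ℝ)).mul_const
    (csq i x * (if b = b' then 1 else 0) - x (i, b') * x (i, b))).const_add
    (csq i x * x (j, b) - (colourVec x i ⬝ᵥ colourVec x j) * x (i, b))).div_const (rho ε i x)
  simpa using h

/-- Continuity of `|x_i|²`. [cite: SimonB1983DiscreteSpectrum, §2 eq. (5)] -/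
theorem continuous_csq (i : Fin 3) : Continuous (csq i) := by
  have : csq i = fun x => ∑ b, x (i, b) ^ 2 := funext (csq_eq_sum i)
  rw [this]
  exact continuous_finsetSum _ fun b _ => (continuous_coord (i, b)).pow 2

/-- Continuity of `x_i · x_j`. [cite: SimonB1983DiscreteSpectrum, §2 eq. (5)] -/
theorem continuous_dot (i j : Fin 3) : Continuous fun x : ZM => colourVec x i ⬝ᵥ colourVec x j :=
  continuous_finsetSum _ fun b _ => (continuous_coord (i, b)).mul (continuous_coord (j, b))

/-- Continuity of `|x_i × x_j|²`. [cite: SimonB1983DiscreteSpectrum, eq. (3) p. 211] -/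
theorem continuous_crossSq (i j : Fin 3) : Continuous (crossSq i j) := by
  have : crossSq i j = fun x => csq i x * csq j x -
      (colourVec x i ⬝ᵥ colourVec x j) * (colourVec x i ⬝ᵥ colourVec x j) := by
    funext x
    rw [crossSq, cross_dot_cross, csq, csq, dotProduct_comm (colourVec x j) (colourVec x i)]
  rw [this]
  exact ((continuous_csq i).mul (continuous_csq j)).sub ((continuous_dot i j).mul (continuous_dot i j))

/-- Continuity of `ρ_ε`. [cite: SimonB1983DiscreteSpectrum, §2 eq. (5)] -/
theorem continuous_rho (ε : ℝ) (i : Fin 3) : Continuous (rho ε i) :=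
  Real.continuous_sqrt.comp ((continuous_csq i).add continuous_const)

/-- Continuity of the smoothed field (`ε > 0`). [cite: SimonB1983DiscreteSpectrum, §2 eq. (5)] -/
theorem continuous_tfield {ε : ℝ} (hε : 0 < ε) (i j b : Fin 3) : Continuous (tfield ε i j b) :=
  (((continuous_csq i).mul (continuous_coord (j, b))).sub
    ((continuous_dot i j).mul (continuous_coord (i, b)))).div (continuous_rho ε i)
    fun x => (rho_pos hε i x).ne'

/-- Continuity of its derivative (`ε > 0`). [cite: SimonB1983DiscreteSpectrum, §2 eq. (5)] -/
theorem continuous_tderiv {ε : ℝ} (hε : 0 < ε) (i b : Fin 3) : Continuous (tderiv ε i b) :=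
  ((continuous_csq i).sub ((continuous_coord (i, b)).pow 2)).div (continuous_rho ε i)
    fun x => (rho_pos hε i x).ne'

/-- The smoothed zero-point weight dominates the true one up to `ε`:
`2|x_i|²/ρ_ε ≥ 2(|x_i| − ε)`. [cite: SimonB1983DiscreteSpectrum, §2 eq. (5)] -/
theorem two_mul_csq_div_rho_ge {ε : ℝ} (hε : 0 < ε) (i : Fin 3) (x : ZM) :
    2 * (Real.sqrt (csq i x) - ε) ≤ 2 * csq i x / rho ε i x := by
  set c := csq i x with hc
  have hc0 : 0 ≤ c := csq_nonneg i x
  set r := Real.sqrt c with hr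
  have hr0 : 0 ≤ r := Real.sqrt_nonneg c
  have hcr : c = r ^ 2 := (Real.sq_sqrt hc0).symm
  have hrho_le : rho ε i x ≤ r + ε := by
    unfold rho
    rw [← hc, hcr]
    calc Real.sqrt (r ^ 2 + ε ^ 2) ≤ Real.sqrt ((r + ε) ^ 2) :=
          Real.sqrt_le_sqrt (by nlinarith [mul_nonneg hr0 hε.le])
      _ = r + ε := Real.sqrt_sq (by linarith)
  have hρ : 0 < rho ε i x := rho_pos hε i x
  rw [mul_div_assoc]
  refine mul_le_mul_of_nonneg_left ?_ (by norm_num)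
  rw [le_div_iff₀ hρ]
  calc (r - ε) * rho ε i x ≤ (r - ε) * (r + ε) ⊔ 0 := by
          rcases le_or_gt 0 (r - ε) with h | h
          · exact (mul_le_mul_of_nonneg_left hrho_le h).trans (le_sup_left)
          · exact (mul_nonpos_of_nonpos_of_nonneg h.le hρ.le).trans le_sup_right
    _ ≤ c := by
          rw [hcr]
          exact sup_le (by nlinarith [sq_nonneg ε]) (sq_nonneg r)


/-! ### 3. Test functions: continuity, supports, integrability, line derivatives -/

section TestFn

variable {ψ : ZM → ℝ}

/-- Test functions are differentiable. [cite: ReedSimonIV1978, Thm. XIII.2] -/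
theorem IsTestFn.differentiable (hψ : IsTestFn ψ) : Differentiable ℝ ψ :=
  hψ.1.differentiable (by norm_num)

/-- Test functions are continuous. [cite: ReedSimonIV1978, Thm. XIII.2] -/
theorem IsTestFn.continuous (hψ : IsTestFn ψ) : Continuous ψ := hψ.1.continuous

/-- The partial derivatives of a test function are continuous. [cite: ReedSimonIV1978, Thm. XIII.2] -/
theorem IsTestFn.continuous_pderiv (hψ : IsTestFn ψ) (p : Fin 3 × Fin 3) : Continuous (pderiv p ψ) :=
  (hψ.1.continuous_fderiv (by norm_num)).clm_apply continuous_const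

/-- The partial derivatives of a test function have compact support. [cite: ReedSimonIV1978, Thm. XIII.2] -/
theorem IsTestFn.hasCompactSupport_pderiv (hψ : IsTestFn ψ) (p : Fin 3 × Fin 3) :
    HasCompactSupport (pderiv p ψ) :=
  hψ.2.fderiv_apply (𝕜 := ℝ) (unitDir p)

/-- `ψ²` has compact support. [cite: ReedSimonIV1978, Thm. XIII.2] -/
theorem IsTestFn.hasCompactSupport_sq (hψ : IsTestFn ψ) : HasCompactSupport fun x => ψ x ^ 2 :=
  hψ.2.comp_left (g := fun t : ℝ => t ^ 2) (by simp)

/-- The partial derivative `∂_p ψ` IS the line derivative of `ψ` along `e_p`. [cite: ReedSimonIV1978, Thm. XIII.2] -/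
theorem IsTestFn.hasLineDerivAt (hψ : IsTestFn ψ) (x : ZM) (p : Fin 3 × Fin 3) :
    HasLineDerivAt ℝ ψ (pderiv p ψ x) x (unitDir p) :=
  (hψ.differentiable x).hasFDerivAt.hasLineDerivAt (unitDir p)

/-- Product rule for line derivatives of real functions. [folklore] -/
private theorem hasLineDerivAt_mul' {f g : ZM → ℝ} {f' g' : ℝ} {x v : ZM}
    (hf : HasLineDerivAt ℝ f f' x v) (hg : HasLineDerivAt ℝ g g' x v) :
    HasLineDerivAt ℝ (fun y => f y * g y) (f' * g x + f x * g') x v := by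
  unfold HasLineDerivAt at hf hg ⊢
  have h := hf.mul hg
  simp only [zero_smul, add_zero] at h
  exact h

/-- A continuous function times a compactly supported continuous function is integrable. [folklore] -/
private theorem integrable_mul_of_hasCompactSupport {f g : ZM → ℝ} (hf : Continuous f)
    (hg : Continuous g) (hgs : HasCompactSupport g) : Integrable (fun x => f x * g x) :=
  (hf.mul hg).integrable_of_hasCompactSupport hgs.mul_left

/-- `ψ²` is integrable. [cite: ReedSimonIV1978, Thm. XIII.2] -/
theorem IsTestFn.integrable_sq (hψ : IsTestFn ψ) : Integrable fun x => ψ x ^ 2 :=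
  (hψ.continuous.pow 2).integrable_of_hasCompactSupport hψ.hasCompactSupport_sq

/-- `w ψ²` is integrable for continuous `w`. [cite: ReedSimonIV1978, Thm. XIII.2] -/
theorem IsTestFn.integrable_mul_sq (hψ : IsTestFn ψ) {w : ZM → ℝ} (hw : Continuous w) :
    Integrable fun x => w x * ψ x ^ 2 :=
  integrable_mul_of_hasCompactSupport hw (hψ.continuous.pow 2) hψ.hasCompactSupport_sq

/-- `(∂_p ψ)²` is integrable. [cite: ReedSimonIV1978, Thm. XIII.2] -/
theorem IsTestFn.integrable_pderiv_sq (hψ : IsTestFn ψ) (p : Fin 3 × Fin 3) :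
    Integrable fun x => (pderiv p ψ x) ^ 2 := by
  have h := integrable_mul_of_hasCompactSupport (hψ.continuous_pderiv p) (hψ.continuous_pderiv p)
    (hψ.hasCompactSupport_pderiv p)
  simpa [sq] using h

/-! ### 4. One transverse block: `∫ Σ_b (∂_{(j,b)}ψ)² + ∫ |x_i × x_j|² ψ² ≥ 2 ∫ |x_i| ψ²` -/

/-- **Integration by parts against the transverse field** (`i ≠ j`, `ε > 0`):
`2 ∫ ψ F^{ε}_b ∂_{(j,b)}ψ = −∫ (∂_{(j,b)} F^{ε}_b) ψ²` — no boundary terms (compact support).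
[cite: SimonB1983DiscreteSpectrum, §2 eq. (5)] -/
theorem two_mul_integral_tfield_pderiv (hψ : IsTestFn ψ) {i j : Fin 3} (hij : i ≠ j) {ε : ℝ}
    (hε : 0 < ε) (b : Fin 3) :
    2 * ∫ x, ψ x * tfield ε i j b x * pderiv (j, b) ψ x = - ∫ x, tderiv ε i b x * ψ x ^ 2 := by
  have hψc := hψ.continuous
  have hFc := continuous_tfield hε i j b
  have hF'c := continuous_tderiv hε i b
  have hDc := hψ.continuous_pderiv (j, b)
  have I1 : Integrable (fun x => (ψ x * tfield ε i j b x) * pderiv (j, b) ψ x) :=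
    integrable_mul_of_hasCompactSupport (hψc.mul hFc) hDc (hψ.hasCompactSupport_pderiv (j, b))
  have I2 : Integrable
      (fun x => (pderiv (j, b) ψ x * tfield ε i j b x + ψ x * tderiv ε i b x) * ψ x) :=
    integrable_mul_of_hasCompactSupport ((hDc.mul hFc).add (hψc.mul hF'c)) hψc hψ.2
  have I3 : Integrable (fun x => (ψ x * tfield ε i j b x) * ψ x) :=
    integrable_mul_of_hasCompactSupport (hψc.mul hFc) hψc hψ.2
  have I4 : Integrable (fun x => tderiv ε i b x * ψ x ^ 2) := hψ.integrable_mul_sq hF'c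
  have hf : ∀ x ∈ tsupport ψ, HasLineDerivAt ℝ (fun y => ψ y * tfield ε i j b y)
      (pderiv (j, b) ψ x * tfield ε i j b x + ψ x * tderiv ε i b x) x (unitDir (j, b)) := by
    intro x _
    have h1 := hasLineDerivAt_mul' (hψ.hasLineDerivAt x (j, b)) (hasLineDerivAt_tfield hij ε b b x)
    convert h1 using 2
    simp [tderiv, sq]
  have key := integral_bilinear_hasLineDerivAt_right_eq_neg_left_of_integrable (μ := volume)
    (B := ContinuousLinearMap.mul ℝ ℝ) (f := fun x => ψ x * tfield ε i j b x)
    (f' := fun x => pderiv (j, b) ψ x * tfield ε i j b x + ψ x * tderiv ε i b x)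
    (g := ψ) (g' := pderiv (j, b) ψ) (v := unitDir (j, b))
    (by simpa only [ContinuousLinearMap.mul_apply'] using I2)
    (by simpa only [ContinuousLinearMap.mul_apply'] using I1)
    (by simpa only [ContinuousLinearMap.mul_apply'] using I3)
    hf (fun x _ => hψ.hasLineDerivAt x (j, b))
  simp only [ContinuousLinearMap.mul_apply'] at key
  have hsplit : ∫ x, (pderiv (j, b) ψ x * tfield ε i j b x + ψ x * tderiv ε i b x) * ψ x =
      (∫ x, ψ x * tfield ε i j b x * pderiv (j, b) ψ x) + ∫ x, tderiv ε i b x * ψ x ^ 2 := by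
    rw [← integral_add I1 I4]
    refine integral_congr_ae (Eventually.of_forall fun x => ?_)
    ring
  linarith

/-- **One transverse block** (`i ≠ j`): the `x_j`-kinetic energy plus the transverse potential
`|x_i × x_j|²` dominate twice the valley distance `|x_i|` — two transverse harmonic oscillators of
frequency `|x_i|`, each with zero-point energy `|x_i|/2` per `½(p² + ω²q²)`, Simon's
"`−d²/dy² + x²y² ≥ |x|`, treating `x` as a c-number":
`2 ∫ |x_i| ψ² ≤ ∫ Σ_b (∂_{(j,b)}ψ)² + ∫ |x_i × x_j|² ψ²`.
Proof: `0 ≤ Σ_b (∂_{(j,b)}ψ + F^{ε}_b ψ)²` pointwise, `Σ_b (F^{ε}_b)² ≤ |x_i × x_j|²`, the cross term is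
`−∫ (div F^{ε}) ψ² = −∫ (2|x_i|²/ρ_ε) ψ² ≤ −2∫(|x_i| − ε)ψ²` by parts, and `ε ↓ 0`.
[cite: SimonB1983DiscreteSpectrum, §2 eq. (5)] -/
theorem two_mul_integral_sqrt_csq_le_block (hψ : IsTestFn ψ) {i j : Fin 3} (hij : i ≠ j) :
    2 * ∫ x, Real.sqrt (csq i x) * ψ x ^ 2 ≤
      (∫ x, ∑ b, (pderiv (j, b) ψ x) ^ 2) + ∫ x, crossSq i j x * ψ x ^ 2 := by
  have hψc := hψ.continuous
  set M : ℝ := ∫ x, ψ x ^ 2 with hM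
  have hM0 : 0 ≤ M := integral_nonneg fun x => sq_nonneg _
  have IS : Integrable (fun x => ∑ b, (pderiv (j, b) ψ x) ^ 2) :=
    integrable_finsetSum _ fun b _ => hψ.integrable_pderiv_sq (j, b)
  have IT : Integrable (fun x => crossSq i j x * ψ x ^ 2) := hψ.integrable_mul_sq (continuous_crossSq i j)
  have Isq : Integrable (fun x => Real.sqrt (csq i x) * ψ x ^ 2) :=
    hψ.integrable_mul_sq (Real.continuous_sqrt.comp (continuous_csq i))
  refine le_of_forall_pos_le_add fun δ hδ => ?_
  -- the smoothing parameter
  set ε : ℝ := δ / (2 * M + 1) with hεdef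
  have hε : 0 < ε := div_pos hδ (by linarith)
  have hεM : 2 * ε * M ≤ δ := by
    have h1 : 2 * ε * M = δ * (2 * M / (2 * M + 1)) := by
      rw [hεdef]; field_simp
    rw [h1]
    have h2 : 2 * M / (2 * M + 1) ≤ 1 := by
      rw [div_le_one (by linarith)]; linarith
    nlinarith
  -- (a) the pointwise square
  have hpt : ∀ x, 0 ≤ (∑ b, (pderiv (j, b) ψ x) ^ 2) + crossSq i j x * ψ x ^ 2 +
      2 * ∑ b, ψ x * tfield ε i j b x * pderiv (j, b) ψ x := by
    intro x
    have h0 : 0 ≤ ∑ b, (pderiv (j, b) ψ x + tfield ε i j b x * ψ x) ^ 2 :=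
      Finset.sum_nonneg fun b _ => sq_nonneg _
    have hexp : ∑ b, (pderiv (j, b) ψ x + tfield ε i j b x * ψ x) ^ 2 =
        (∑ b, (pderiv (j, b) ψ x) ^ 2) + (∑ b, (tfield ε i j b x) ^ 2) * ψ x ^ 2 +
          2 * ∑ b, ψ x * tfield ε i j b x * pderiv (j, b) ψ x := by
      rw [Finset.sum_mul, Finset.mul_sum, ← Finset.sum_add_distrib, ← Finset.sum_add_distrib]
      exact Finset.sum_congr rfl fun b _ => by ring
    have hF := mul_le_mul_of_nonneg_right (sum_tfield_sq_le ε i j x) (sq_nonneg (ψ x))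
    linarith
  -- (b) integrate the square
  have Icross : ∀ b, Integrable (fun x => ψ x * tfield ε i j b x * pderiv (j, b) ψ x) := fun b =>
    integrable_mul_of_hasCompactSupport (hψc.mul (continuous_tfield hε i j b))
      (hψ.continuous_pderiv (j, b)) (hψ.hasCompactSupport_pderiv (j, b))
  have Isum : Integrable (fun x => ∑ b, ψ x * tfield ε i j b x * pderiv (j, b) ψ x) :=
    integrable_finsetSum _ fun b _ => Icross b
  have hint : 0 ≤ (∫ x, ∑ b, (pderiv (j, b) ψ x) ^ 2) + (∫ x, crossSq i j x * ψ x ^ 2) +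
      2 * ∑ b, ∫ x, ψ x * tfield ε i j b x * pderiv (j, b) ψ x := by
    have h : 0 ≤ ∫ x, ((∑ b, (pderiv (j, b) ψ x) ^ 2) + crossSq i j x * ψ x ^ 2 +
        2 * ∑ b, ψ x * tfield ε i j b x * pderiv (j, b) ψ x) := integral_nonneg hpt
    have IST : Integrable (fun x => (∑ b, (pderiv (j, b) ψ x) ^ 2) + crossSq i j x * ψ x ^ 2) :=
      IS.add IT
    have I2s : Integrable (fun x => 2 * ∑ b, ψ x * tfield ε i j b x * pderiv (j, b) ψ x) :=
      Isum.const_mul 2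
    rw [integral_add IST I2s, integral_add IS IT, integral_const_mul,
      integral_finsetSum _ (fun b _ => Icross b)] at h
    exact h
  -- (c) the cross term by parts: `2 Σ_b ∫ ψ F_b ∂_b ψ = −∫ (2|x_i|²/ρ_ε) ψ²`
  have hparts : 2 * ∑ b, ∫ x, ψ x * tfield ε i j b x * pderiv (j, b) ψ x =
      - ∫ x, (2 * csq i x / rho ε i x) * ψ x ^ 2 := by
    rw [Finset.mul_sum]
    simp_rw [two_mul_integral_tfield_pderiv hψ hij hε]
    rw [Finset.sum_neg_distrib, ← integral_finsetSum _ (fun b _ => hψ.integrable_mul_sq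
      (continuous_tderiv hε i b))]
    congr 1
    refine integral_congr_ae (Eventually.of_forall fun x => ?_)
    dsimp only
    rw [← Finset.sum_mul, sum_tderiv]
  -- (d) the smoothed weight dominates `2(|x_i| − ε)`
  have Iw : Integrable (fun x => (2 * csq i x / rho ε i x) * ψ x ^ 2) :=
    hψ.integrable_mul_sq (((continuous_csq i).const_mul 2).div (continuous_rho ε i)
      fun x => (rho_pos hε i x).ne')
  have hdom : 2 * (∫ x, Real.sqrt (csq i x) * ψ x ^ 2) - 2 * ε * M ≤
      ∫ x, (2 * csq i x / rho ε i x) * ψ x ^ 2 := by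
    have h1 : 2 * (∫ x, Real.sqrt (csq i x) * ψ x ^ 2) - 2 * ε * M =
        ∫ x, 2 * (Real.sqrt (csq i x) - ε) * ψ x ^ 2 := by
      rw [hM, ← integral_const_mul, ← integral_const_mul, ← integral_sub (Isq.const_mul 2)
        (hψ.integrable_sq.const_mul (2 * ε))]
      refine integral_congr_ae (Eventually.of_forall fun x => ?_)
      simp only
      ring
    rw [h1]
    refine integral_mono ?_ Iw fun x => ?_
    · have := (Isq.const_mul 2).sub (hψ.integrable_sq.const_mul (2 * ε))
      refine this.congr (Eventually.of_forall fun x => ?_)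
      simp only [Pi.sub_apply]
      ring
    · exact mul_le_mul_of_nonneg_right (two_mul_csq_div_rho_ge hε i x) (sq_nonneg _)
  linarith

end TestFn

/-! ### 5. Assembly: `𝔮(ψ) ≥ 2 ∫ |x_i| ψ²`, `𝔮(ψ) ≥ ⅔ ∫ ‖x‖ ψ²` -/

section Assembly

variable {ψ : ZM → ℝ}

/-- The energy form in coordinates: `𝔮(ψ) = ∫ ½ Σ_p (∂_pψ)² + ¼ Σ_{i,j} |x_i × x_j|² ψ²`.
[cite: ReedSimonIV1978, Thm. XIII.2] -/
theorem energyForm_eq_integral_sum (ψ : ZM → ℝ) : energyForm ψ =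
    ∫ x, ((1 / 2 : ℝ) * ∑ p, (pderiv p ψ x) ^ 2 + ((1 / 4 : ℝ) * ∑ i, ∑ j, crossSq i j x) * ψ x ^ 2) := by
  unfold energyForm
  congr 1
  funext x
  rw [norm_gradient_sq, luscherPotential_eq_sum_crossSq]

/-- `𝔮(ψ) ≥ 0`. [cite: ReedSimonIV1978, Thm. XIII.2] -/
theorem energyForm_nonneg (ψ : ZM → ℝ) : 0 ≤ energyForm ψ :=
  integral_nonneg fun x => add_nonneg (mul_nonneg (by norm_num) (sq_nonneg _))
    (mul_nonneg (luscherPotential_nonneg x) (sq_nonneg _))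

/-- Potential bookkeeping: `½ Σ_{j ≠ i} |x_i × x_j|² ≤ V(x) = ¼ Σ_{i',j} |x_{i'} × x_j|²` (the pairs
`(i,j)` and `(j,i)`, `j ≠ i`, each occur once). [cite: SimonB1983DiscreteSpectrum, eq. (3) p. 211] -/
theorem half_sum_crossSq_le_potential (i : Fin 3) (x : ZM) :
    (1 / 2 : ℝ) * ∑ j ∈ Finset.univ.erase i, crossSq i j x ≤ (1 / 4 : ℝ) * ∑ i', ∑ j, crossSq i' j x := by
  have h1 : ∑ i', ∑ j, crossSq i' j x =
      ∑ j, crossSq i j x + ∑ i' ∈ Finset.univ.erase i, ∑ j, crossSq i' j x :=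
    (Finset.add_sum_erase _ _ (Finset.mem_univ i)).symm
  have h2 : ∑ j, crossSq i j x = ∑ j ∈ Finset.univ.erase i, crossSq i j x := by
    rw [← Finset.add_sum_erase _ _ (Finset.mem_univ i), crossSq_self, zero_add]
  have h3 : ∀ i' ∈ Finset.univ.erase i, crossSq i i' x ≤ ∑ j, crossSq i' j x := fun i' _ => by
    rw [crossSq_comm]
    exact Finset.single_le_sum (fun j _ => crossSq_nonneg i' j x) (Finset.mem_univ i)
  have h4 := Finset.sum_le_sum h3
  linarith

/-- Kinetic bookkeeping: `Σ_{j ≠ i} Σ_b (∂_{(j,b)}ψ)² ≤ Σ_p (∂_pψ)²`. [cite: SimonB1983DiscreteSpectrum, §2 eq. (5)] -/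
theorem sum_erase_pderiv_sq_le (ψ : ZM → ℝ) (i : Fin 3) (x : ZM) :
    ∑ j ∈ Finset.univ.erase i, ∑ b, (pderiv (j, b) ψ x) ^ 2 ≤ ∑ p, (pderiv p ψ x) ^ 2 := by
  rw [Fintype.sum_prod_type]
  exact Finset.sum_le_sum_of_subset_of_nonneg (Finset.erase_subset _ _)
    fun j _ _ => Finset.sum_nonneg fun b _ => sq_nonneg _

/-- **Simon's zero-point bound for the `SU(2)` matrix model (valley confinement), per direction.**
For every `C²_c` trial function `ψ` on `ℝ⁹` and every spatial direction `i`,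
`2 ∫ |x_i| ψ(x)² dx ≤ 𝔮(ψ) = ∫ ½|∇ψ|² + V ψ²`, `|x_i| = (x_i · x_i)^{1/2}`:
as a quadratic form `𝔥 = −½Δ + ¼Σ|x_i × x_j|² ≥ 2|x_i|`.  Along the classical vacuum valley (all
`x_j` parallel, `V = 0`) the four transverse oscillators in the two blocks `j ≠ i` have frequency
`|x_i|` and zero-point energy `4 · |x_i|/2` — Lüscher's linearly rising effective potential, made a
rigorous form inequality by Simon's first proof ("zero point oscillator motion",
`−d²/dy² + x²y² ≥ |x|` ⇒ eq. (5)), here transported from `x²y²` to the operator (3) of op. cit.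
with `𝔞 = su(2) ≅ (ℝ³, ×)`, `ν = 3` (for which op. cit. Cor. 4 argues via Fefferman–Phong instead).
[cite: SimonB1983DiscreteSpectrum, §2 eq. (5); Cor. 4 p. 217] [cite: Luscher1983, §2] -/
theorem two_mul_integral_colourNorm_sq_le_energyForm (hψ : IsTestFn ψ) (i : Fin 3) :
    2 * ∫ x, Real.sqrt (colourVec x i ⬝ᵥ colourVec x i) * ψ x ^ 2 ≤ energyForm ψ := by
  change 2 * ∫ x, Real.sqrt (csq i x) * ψ x ^ 2 ≤ energyForm ψ
  set L : ZM → ℝ := fun x => ∑ j ∈ Finset.univ.erase i,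
    ((1 / 2 : ℝ) * ∑ b, (pderiv (j, b) ψ x) ^ 2 + (1 / 2 : ℝ) * (crossSq i j x * ψ x ^ 2)) with hL
  have Ij : ∀ j, Integrable (fun x => (1 / 2 : ℝ) * ∑ b, (pderiv (j, b) ψ x) ^ 2 +
      (1 / 2 : ℝ) * (crossSq i j x * ψ x ^ 2)) := fun j =>
    ((integrable_finsetSum _ fun b _ => hψ.integrable_pderiv_sq (j, b)).const_mul _).add
      ((hψ.integrable_mul_sq (continuous_crossSq i j)).const_mul _)
  have IL : Integrable L := integrable_finsetSum _ fun j _ => Ij j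
  have Iint : Integrable (fun x => (1 / 2 : ℝ) * ∑ p, (pderiv p ψ x) ^ 2 +
      ((1 / 4 : ℝ) * ∑ i', ∑ j, crossSq i' j x) * ψ x ^ 2) :=
    ((integrable_finsetSum _ fun p _ => hψ.integrable_pderiv_sq p).const_mul _).add
      (hψ.integrable_mul_sq (continuous_const.mul (continuous_finsetSum _ fun i' _ =>
        continuous_finsetSum _ fun j _ => continuous_crossSq i' j)))
  -- pointwise: `L ≤` the energy integrand
  have hLle : ∀ x, L x ≤ (1 / 2 : ℝ) * ∑ p, (pderiv p ψ x) ^ 2 +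
      ((1 / 4 : ℝ) * ∑ i', ∑ j, crossSq i' j x) * ψ x ^ 2 := by
    intro x
    have hk := sum_erase_pderiv_sq_le ψ i x
    have hp := mul_le_mul_of_nonneg_right (half_sum_crossSq_le_potential i x) (sq_nonneg (ψ x))
    have hLx : L x = (1 / 2 : ℝ) * ∑ j ∈ Finset.univ.erase i, ∑ b, (pderiv (j, b) ψ x) ^ 2 +
        ((1 / 2 : ℝ) * ∑ j ∈ Finset.univ.erase i, crossSq i j x) * ψ x ^ 2 := by
      rw [hL]
      simp only [Finset.sum_add_distrib, ← Finset.mul_sum, ← Finset.sum_mul]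
      ring
    rw [hLx]
    linarith
  -- integrate
  have step1 : ∫ x, L x ≤ energyForm ψ := by
    rw [energyForm_eq_integral_sum]
    exact integral_mono IL Iint hLle
  have step2 : ∫ x, L x = ∑ j ∈ Finset.univ.erase i, ((1 / 2 : ℝ) * (∫ x, ∑ b, (pderiv (j, b) ψ x) ^ 2) +
      (1 / 2 : ℝ) * ∫ x, crossSq i j x * ψ x ^ 2) := by
    rw [hL, integral_finsetSum _ (fun j _ => Ij j)]
    refine Finset.sum_congr rfl fun j _ => ?_
    rw [integral_add ((integrable_finsetSum _ fun b _ => hψ.integrable_pderiv_sq (j, b)).const_mul _)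
      ((hψ.integrable_mul_sq (continuous_crossSq i j)).const_mul _), integral_const_mul, integral_const_mul]
  have step3 : ∀ j ∈ Finset.univ.erase i, (∫ x, Real.sqrt (csq i x) * ψ x ^ 2) ≤
      (1 / 2 : ℝ) * (∫ x, ∑ b, (pderiv (j, b) ψ x) ^ 2) + (1 / 2 : ℝ) * ∫ x, crossSq i j x * ψ x ^ 2 := by
    intro j hj
    have hij : i ≠ j := (Finset.ne_of_mem_erase hj).symm
    have h := two_mul_integral_sqrt_csq_le_block hψ hij
    linarith
  have step4 : ∑ j ∈ Finset.univ.erase i, (∫ x, Real.sqrt (csq i x) * ψ x ^ 2) ≤ ∫ x, L x := by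
    rw [step2]
    exact Finset.sum_le_sum step3
  have hcard : (Finset.univ.erase i).card = 2 := by
    rw [Finset.card_erase_of_mem (Finset.mem_univ i), Finset.card_univ, Fintype.card_fin]
  rw [Finset.sum_const, hcard, nsmul_eq_mul, Nat.cast_ofNat] at step4
  linarith

/-- **Direction-averaged form**: `⅔ ∫ (|x_1| + |x_2| + |x_3|) ψ² ≤ 𝔮(ψ)`, i.e.
`𝔥 ≥ ⅔ Σ_i |x_i|` — the analogue of Simon's eq. (5) `H₁ ≥ ½(−Δ) + ½(|x| + |y|)` for operator (3).
[cite: SimonB1983DiscreteSpectrum, §2 eq. (5)] -/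
theorem integral_sum_colourNorm_sq_le_energyForm (hψ : IsTestFn ψ) :
    (2 / 3 : ℝ) * ∫ x, (∑ i, Real.sqrt (colourVec x i ⬝ᵥ colourVec x i)) * ψ x ^ 2 ≤ energyForm ψ := by
  have I : ∀ i, Integrable (fun x => Real.sqrt (colourVec x i ⬝ᵥ colourVec x i) * ψ x ^ 2) := fun i =>
    hψ.integrable_mul_sq (Real.continuous_sqrt.comp (continuous_csq i))
  have h : ∫ x, (∑ i, Real.sqrt (colourVec x i ⬝ᵥ colourVec x i)) * ψ x ^ 2 =
      ∑ i, ∫ x, Real.sqrt (colourVec x i ⬝ᵥ colourVec x i) * ψ x ^ 2 := by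
    rw [← integral_finsetSum _ (fun i _ => I i)]
    refine integral_congr_ae (Eventually.of_forall fun x => ?_)
    simp only [Finset.sum_mul]
  rw [h, Fin.sum_univ_three]
  have h0 := two_mul_integral_colourNorm_sq_le_energyForm hψ 0
  have h1 := two_mul_integral_colourNorm_sq_le_energyForm hψ 1
  have h2 := two_mul_integral_colourNorm_sq_le_energyForm hψ 2
  linarith

/-- `‖x‖ ≤ Σ_i |x_i|` on `ℝ⁹ = (ℝ³)³`. [cite: SimonB1983DiscreteSpectrum, §2 eq. (5)] -/
theorem norm_le_sum_colourNorm (x : ZM) : ‖x‖ ≤ ∑ i, Real.sqrt (colourVec x i ⬝ᵥ colourVec x i) := by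
  have hs : ∀ i, 0 ≤ Real.sqrt (colourVec x i ⬝ᵥ colourVec x i) := fun i => Real.sqrt_nonneg _
  have hsq : ∀ i, Real.sqrt (colourVec x i ⬝ᵥ colourVec x i) ^ 2 = csq i x := fun i =>
    Real.sq_sqrt (csq_nonneg i x)
  rw [← sq_le_sq₀ (norm_nonneg x) (Finset.sum_nonneg fun i _ => hs i), norm_sq_eq_sum_csq,
    Fin.sum_univ_three, Fin.sum_univ_three, ← hsq 0, ← hsq 1, ← hsq 2]
  nlinarith [mul_nonneg (hs 0) (hs 1), mul_nonneg (hs 0) (hs 2), mul_nonneg (hs 1) (hs 2)]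

/-- **Valley confinement in the radial variable**: `⅔ ∫ ‖x‖ ψ(x)² dx ≤ 𝔮(ψ)` for every `C²_c` trial
function — the quartic potential vanishes on the 5-dimensional valley, yet the FORM of `𝔥` dominates
the linearly confining weight `⅔‖x‖` (Simon: the operators "fail to go to infinity at infinity but
only on very thin sets"; eq. (5)). [cite: SimonB1983DiscreteSpectrum, §2 eq. (5); §1 p. 211] -/
theorem integral_norm_sq_le_energyForm (hψ : IsTestFn ψ) :
    (2 / 3 : ℝ) * ∫ x, ‖x‖ * ψ x ^ 2 ≤ energyForm ψ := by
  refine le_trans ?_ (integral_sum_colourNorm_sq_le_energyForm hψ)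
  refine mul_le_mul_of_nonneg_left ?_ (by norm_num)
  refine integral_mono (hψ.integrable_mul_sq continuous_norm)
    (hψ.integrable_mul_sq (continuous_finsetSum _ fun i _ => Real.continuous_sqrt.comp (continuous_csq i)))
    fun x => ?_
  exact mul_le_mul_of_nonneg_right (norm_le_sum_colourNorm x) (sq_nonneg _)

/-- **Simon's eq. (5) shape**: `𝔮(ψ) ≥ ½ 𝔮(ψ) + ⅓ ∫ ‖x‖ ψ²` — keep half the Hamiltonian and gain a
confining weight, `𝔥 ≥ ½𝔥 + ⅓‖x‖` (op. cit.: `H₁ ≥ ½(−Δ) + ½(|x|+|y|) = H₃`, "since `H₃` has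
discrete spectrum, so does `H₁`"; the compactness half of that sentence is NOT proved here).
[cite: SimonB1983DiscreteSpectrum, §2 eq. (5)] -/
theorem energyForm_ge_half_add_third_integral_norm (hψ : IsTestFn ψ) :
    energyForm ψ / 2 + (1 / 3 : ℝ) * ∫ x, ‖x‖ * ψ x ^ 2 ≤ energyForm ψ := by
  have h := integral_norm_sq_le_energyForm hψ
  linarith

/-- **Localisation of low-energy trial states**: if `𝔮(ψ) ≤ s ‖ψ‖²` (Rayleigh quotient `≤ s`, the
condition in `minmaxLevel`) then `∫ ‖x‖ ψ² ≤ (3/2) s ‖ψ‖²` — a trial state of energy `≤ s` has mean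
valley distance `≤ 3s/2`; the input a compactness (Rellich) argument for `μ_k → ∞` would consume.
[cite: SimonB1983DiscreteSpectrum, §2 eq. (5)] [cite: ReedSimonIV1978, Thm. XIII.64 (i)⇔(vi)] -/
theorem integral_norm_sq_le_of_energyForm_le (hψ : IsTestFn ψ) {s : ℝ}
    (h : energyForm ψ ≤ s * l2sq ψ) : ∫ x, ‖x‖ * ψ x ^ 2 ≤ (3 / 2 : ℝ) * s * l2sq ψ := by
  have h1 := integral_norm_sq_le_energyForm hψ
  unfold l2sq at h ⊢
  linarith

end Assembly

end Literature.Analysis.OperatorTheory.YMMatrixModel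

end
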